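import Summits.CriticalPhenomena.CardyFormulaZ2.Theses.CardyIKTransport
import Summits.CriticalPhenomena.CardyFormulaZ2.Theorems.CornerLineDescent.Negative.CornerFaceNoMonotone
import Summits.CriticalPhenomena.CardyFormulaZ2.Theorems.CornerLineDescent.Negative.QuadrantFlipLocal

/-!
# Line `dislocation-gas-endgame` — skeleton for crux `CornerLineDescent` (stmt-CriticalPhenomena-10964)

Route `CardyIKTransport` (r3), crux decl
`Summit.CriticalPhenomena.CardyFormulaZ2.Theses.CardyIKTransport.CornerLineDescent`:
Cardy for the isotropic Izergin–Korepin gauge `P_IK` in every conformal rectangle ⇒ Cardy for the crude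
bond-ℤ² event at `p = ½` on the standard embedding in every conformal rectangle.

The crux's inline i.i.d.-bit gauge is abstracted in the plaquette-defect DENSITY `p` and in a modifier `F` of
the defect field (`gaugeCrossingProbWith p F`; `F = id` gives `gaugeCrossingProb p`): `p = pIK = 2√3 − 3` is the
crux's `P_IK` BY `Iff.rfl` (`cornerLineDescent_iff`), `p = 0` is bond-ℤ² at `½` on the renewal product grid
(FreezeIdentification), `F = insert f` / `(· \ {f})` force the bit at `f`, and one forced plaquette defect is one
`(±1,±1)` edge dislocation of that lattice (Negative/QuadrantFlipLocal `isOddFace_quadFlip_iff`: toggling a bit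
recolours one quadrant and changes the parity of exactly one face — law-locality).

Line (idea card `Ideas/dislocation-gas-endgame.md`, sharpened by TRIAGE-r1-1/2/3): a two-scale endgame whose
windows OVERLAP at defect density `p = K δ`.
* `stub_signedDislocation` — the SIGNED, environment-averaged single-dislocation influence, summed in absolute
  value over faces, is `o(δ⁻¹)` uniformly over sparse backgrounds `p ≤ K δ` (the triage's named signed lemma;
  unsigned seam × four-arm bounds give only `δ^{1/4}` per dislocation and cannot prove it).
* `stub_russoWindow` — Margulis–Russo in the defect density turns the signed lemma into Regime I
  (`|P_p − P_0| ≤ ε` for all `p ≤ K δ`, EVERY window constant `K`).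
* `stub_largeScale` — the crux ABOVE the window in `ξ_t`-units: under the crux's hypothesis, for every `R, ε`
  SOME window constant `K` makes `|P_IK − P_{Kδ}| ≤ ε` eventually (hardest stub; any fixed-`t` mechanism).
* `stub_freezeToStandard` — Cardy for the defect-free gauge (bond-ℤ² on the renewal grid, cell event) in every
  conformal rectangle ⇒ Cardy for the standard embedding (in-law homogenisation, 45° covariance).
* `of_parts` (sorry-free, axioms `propext`/`Classical.choice`/`Quot.sound`) composes them into the crux unfolded;
  `CornerLineDescent_of` applies it to the four registered stubs and concludes the crux BY NAME.

Disproof.lean (cdisprove cycle 1) honoured: §B no `_false_without_` exists (only hypothesis `CardyIK`, used here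
by `stub_largeScale`); §C `not_blind_transport`/`not_transport_under` (= Negative/ModelBlindTransport): every
stub is stated over the explicit gauge, none transports Cardy by symmetry; §D / Negative/CornerFaceNoMonotone:
no monotone coupling in `t` is used — the `p`-comparison is Russo's product-measure calculus in the defect bits
(insertion of sparse defects), which §D lists as admissible; §G law-locality / Negative/QuadrantFlipLocal is the
definition of `dislocationInfluence`.
-/

noncomputable section

namespace Summit.CriticalPhenomena.CardyFormulaZ2.Cruxes.CornerLineDescent.DislocationGasEndgame

open scoped BigOperators Topology Classical MeasureTheory
open Filter Set MeasureTheory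
open Literature.Probability.LatticeModels
open Literature.Probability.RandomPlanarGeometry
open Summit.CriticalPhenomena.CardyFormulaZ2.Theses

/-! ## The gauge, abstracted in the defect density `p` and a defect-field modifier `F` -/

/-- Crude crossing probability of `R` at mesh `δ` for the crux's gauge with plaquette-defect density `p`
(clamped to `[0,1]` by `Set.projIcc`) and with the defect field `D = ω.2.2.1` read through `F`
(`F D` in place of `D`).  VERBATIM the crux's let-bound `P` with `2√3 − 3 ↦ p` and `f ∈ ω.2.2.1 ↦ f ∈ F ω.2.2.1`
(so that `F := fun D => D`, `p := pIK` is the crux's `P_IK` definitionally). Five i.i.d. bit fields: column bits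
`A`, row bits `B`, defects `D`, an unused field, saddle coins; colour `A_{v0} ⊕ B_{v1} ⊕ parity(D ∩ Rect(0,v))`;
black graph = same-colour nearest neighbours + the coin-chosen diagonal; cells at `v0 + i v1`. -/
def gaugeCrossingProbWith (p : ℝ) (F : Set (Site 2) → Set (Site 2)) : ConformalRectangle → ℝ → ℝ :=
  (fun R => let μ := (Literature.Probability.Percolation.sitePercolation ℤ Literature.Probability.Percolation.half).prod ((Literature.Probability.Percolation.sitePercolation ℤ Literature.Probability.Percolation.half).prod ((Literature.Probability.Percolation.sitePercolation (Literature.Probability.LatticeModels.Site 2) (Set.projIcc (0:ℝ) 1 zero_le_one p)).prod ((Literature.Probability.Percolation.sitePercolation (Literature.Probability.LatticeModels.Site 2) Literature.Probability.Percolation.half).prod (Literature.Probability.Percolation.sitePercolation (Literature.Probability.LatticeModels.Site 2) Literature.Probability.Percolation.half)))); let par : (Set ℤ × (Set ℤ × (Set (Literature.Probability.LatticeModels.Site 2) × (Set (Literature.Probability.LatticeModels.Site 2) × Set (Literature.Probability.LatticeModels.Site 2))))) → Literature.Probability.LatticeModels.Site 2 → Prop := fun ω f => (f 0 ∈ (Set.univ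 : Set ℤ) ∧ f ∈ F ω.2.2.1) ∨ (f 0 ∉ (Set.univ : Set ℤ) ∧ f ∈ ω.2.2.2.1); let blk : (Set ℤ × (Set ℤ × (Set (Literature.Probability.LatticeModels.Site 2) × (Set (Literature.Probability.LatticeModels.Site 2) × Set (Literature.Probability.LatticeModels.Site 2))))) → Literature.Probability.LatticeModels.Site 2 → Prop := fun ω v => Xor (v 0 ∈ ω.1) (Xor (v 1 ∈ ω.2.1) (Odd ((Finset.filter (fun f : ℤ × ℤ => par ω ![f.1, f.2]) (Finset.Ico (min 0 (v 0)) (max 0 (v 0)) ×ˢ Finset.Ico (min 0 (v 1)) (max 0 (v 1)))).card))); let anti : (Set ℤ × (Set ℤ × (Set (Literature.Probability.LatticeModels.Site 2) × (Set (Literature.Probability.LatticeModels.Site 2) × Set (Literature.Probability.LatticeModels.Site 2))))) → Literature.Probability.LatticeModels.Site 2 → Prop := fun ω f => f 0 ∉ (Set.univ : Set ℤ) ∨ f ∈ ω.2.2.2.2; let edges : (Set ℤ × (Set ℤ × (Set (Literature.Probability.LatticeModels.Site 2) × (Set (Literature.Probability.LatticeModels.Site 2) × Set (Literature.Probability.LatticeModels.Site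 2))))) → Literature.Probability.Percolation.BondConfig (Literature.Probability.LatticeModels.Site 2) := fun ω => {e | ∃ u v, e = s(u, v) ∧ blk ω u ∧ blk ω v ∧ (v = u + ![1, 0] ∨ v = u + ![0, 1] ∨ (v = u + ![1, 1] ∧ ¬ anti ω u) ∨ (v = u + ![1, -1] ∧ anti ω (u + ![0, -1])))}; fun δ : ℝ => μ.real {ω | edges ω ∈ Literature.Probability.Percolation.embDomainCrossing (fun v : Literature.Probability.LatticeModels.Site 2 => ((v 0 : ℝ) : ℂ) + ((v 1 : ℝ) : ℂ) * Complex.I) R.carrier δ (R.arc 0) (R.arc 2)})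

/-- The gauge with defect density `p`, unmodified defect field (`p = pIK`: the crux's `P_IK`; `p = 0`: bond-ℤ²
at `½` on the renewal product grid). -/
def gaugeCrossingProb (p : ℝ) : ConformalRectangle → ℝ → ℝ :=
  gaugeCrossingProbWith p (fun D => D)

/-- The isotropic Izergin–Korepin defect density `2√3 − 3 ≈ 0.464` (corner fugacity `t = p/(1−p) = √3/2`). -/
def pIK : ℝ := 2 * Real.sqrt 3 - 3

/-- The crux's consequent (verbatim): Cardy for bond-ℤ² at `½`, crude event `embDomainCrossing`, standard
embedding `squareLatticeEmbedding.z`, every conformal rectangle. -/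
def CrudeBondCardy : Prop :=
  ∀ R : ConformalRectangle, R.HasCrossingLimit (fun δ ↦ (Literature.Probability.Percolation.bondPercolation (Literature.Probability.LatticeModels.zdGraph 2) Literature.Probability.Percolation.half).real (Literature.Probability.Percolation.embDomainCrossing Literature.Probability.LatticeModels.squareLatticeEmbedding.z R.carrier δ (R.arc 0) (R.arc 2))) cardyFunction

/-- The crux's hypothesis in the abstraction: Cardy for `P_IK = gaugeCrossingProb pIK` in every conformal
rectangle (definitionally `CardyDiluteOrbit.CardyIK`, stmt-5913). -/
def CardyIKHyp : Prop :=
  ∀ R : ConformalRectangle, R.HasCrossingLimit (gaugeCrossingProb pIK R) cardyFunction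

/-- SANITY (`Iff.rfl`): the crux BY NAME is `CardyIKHyp → CrudeBondCardy`. -/
theorem cornerLineDescent_iff :
    CardyIKTransport.CornerLineDescent ↔ (CardyIKHyp → CrudeBondCardy) :=
  Iff.rfl

/-! ## One forced dislocation: the signed, environment-averaged influence -/

/-- The SIGNED single-dislocation influence at background density `p`:
`I_f(p; R, δ) = P_p[A | κ_f = 1] − P_p[A | κ_f = 0]` for the crude crossing event `A` of `R` at mesh `δ`, written
by forcing the independent bit at `f` (`insert f` / `· \ {f}`).  By law-locality (Negative/QuadrantFlipLocal) it is
the response to inverting the corner fugacity at the single face `f`; pathwise the forcing inserts one `(±1,±1)`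
dislocation of the renewal lattice with core `f` (two re-glued rays = pure gauge seams). -/
def dislocationInfluence (p : ℝ) (f : Site 2) (R : ConformalRectangle) (δ : ℝ) : ℝ :=
  gaugeCrossingProbWith p (fun D => insert f D) R δ - gaugeCrossingProbWith p (fun D => D \ {f}) R δ

/-! ## The statements of the line -/

/-- SIGNED DISLOCATION LEMMA (statement of `stub_signedDislocation`). For every conformal rectangle `R`, window
constant `K` and `ε > 0`, eventually as `δ → 0⁺`: for every background density `p ≤ K δ` the signed influences,
summed in absolute value over any finite set of faces, total at most `ε / δ` — `o(δ)` per face on average over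
the `≍ δ⁻²` faces whose quadrant boundary meets the (bounded) window; faces whose quadrant misses or swallows the
window have influence exactly `0` (colour-flip symmetry of the law). The sum form, not a per-face `o(δ)`, is
deliberate: the `O(1)` faces next to a marked point may carry `|I_f| ≍ δ` (wedge two-arm exponent `1`). -/
def SignedDislocationBound : Prop :=
  ∀ (R : ConformalRectangle) (K ε : ℝ), 0 < K → 0 < ε →
    ∀ᶠ δ in 𝓝[>] (0 : ℝ), ∀ p : ℝ, 0 ≤ p → p ≤ K * δ →
      ∀ S : Finset (Site 2), ∑ f ∈ S, |dislocationInfluence p f R δ| ≤ ε / δ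

/-- REGIME I (conclusion of `stub_russoWindow`). Below the window `p ≤ K δ` — `≍ K δ⁻¹` dislocations in the
domain, `O(K)` per grid line, colour correlation length `≥ (2Kδ)⁻¹` lattice units, i.e. macroscopic — the
dislocation gas does not move crude crossing probabilities: for EVERY window constant `K`, eventually in `δ`,
`|P_p(R, δ) − P_0(R, δ)| ≤ ε` for all `0 ≤ p ≤ K δ`. -/
def RegimeOne : Prop :=
  ∀ (R : ConformalRectangle) (ε : ℝ), 0 < ε → ∀ K : ℝ, 0 < K →
    ∀ᶠ δ in 𝓝[>] (0 : ℝ), ∀ p : ℝ, 0 ≤ p → p ≤ K * δ →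
      |gaugeCrossingProb p R δ - gaugeCrossingProb 0 R δ| ≤ ε

/-- LARGE-SCALE IRRELEVANCE IN `ξ_t`-UNITS (statement of `stub_largeScale`; the crux above the window). Under
Cardy for `P_IK`, for every conformal rectangle `R` and `ε > 0` there is a window constant `K > 0` such that,
eventually as `δ → 0⁺`, the gauge at the sparse density `p = K δ` (colour correlation length `≍ (2K)⁻¹` in
macroscopic units: the domain holds `≍ K` correlation lengths) and the isotropic IK gauge have crude crossing
probabilities within `ε`.  Any fixed-`t` corner-irrelevance mechanism whose constants are uniform once lengths
are measured in `ξ_t ≍ 1/t` delivers this (a rate `C (δ/t)^θ = C K^{-θ}` at `t ≍ p = Kδ` is the natural form). -/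
def LargeScaleIrrelevance : Prop :=
  CardyIKHyp →
    ∀ (R : ConformalRectangle) (ε : ℝ), 0 < ε → ∃ K : ℝ, 0 < K ∧
      ∀ᶠ δ in 𝓝[>] (0 : ℝ), |gaugeCrossingProb pIK R δ - gaugeCrossingProb (K * δ) R δ| ≤ ε

/-- FREEZE TO STANDARD (statement of `stub_freezeToStandard`; the `t = 0` end). The defect-free gauge is bond
percolation at `½` on the black-block lattice of the renewal product grid (i.i.d. geometric column/row widths of
mean `2`; black blocks = one checkerboard class, joined diagonally through the fair coins at the grid vertices):
a `45°`-rotated copy of `ℤ²` of spacing `2√2`, embedded with `o(1)` sup-distortion on the domain window with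
probability `→ 1` (SLLN).  Cardy for its crude cell-crossing probabilities in every conformal rectangle
implies Cardy for the standard embedding in every conformal rectangle (in-law homogenisation: compare, on the
typical grid event, with the standard crossing of the `45°`-rotated rectangle at mesh `2δ` by
domain-equicontinuity of bond-ℤ² crossings; isometry covariance of `embDomainCrossing`; `R ↦ e^{iπ/4} R`
is a bijection of conformal rectangles preserving uniformizing data).  Same statement as card
`dislocation-seam-calculus`'s `FreezeToStandard` (pooled). -/
def FreezeToStandard : Prop :=
  (∀ R : ConformalRectangle, R.HasCrossingLimit (gaugeCrossingProb 0 R) cardyFunction) → CrudeBondCardy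

/-! ## Registered stubs -/

/-- **stub_signedDislocation** (hardest stub of the frozen end; L–XL, open). `Σ_f |I_f(p; R, δ)| = o(δ⁻¹)`
uniformly over `p ≤ K δ`.  Intended proof (TRIAGE-r1-2 S1/S2, r1-3): (i) the law of the wall arrangement at
`f` given the bit splits into the four local wall types (empty, V, H, crossing), each of probability EXACTLY
`1/4` at every `p` (one-face algebra: the eight even patterns have weight `1`; Negative/CornerFaceNoMonotone
`cornerFace_three_cells_uniform`), with Burgers vectors `b_empty = −b_cross`, `b_V = −b_H` — sum zero;
(ii) agree-off-a-seam coupling through the developing map of the dislocated lattice: the first-order response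
of a bulk dislocation with core `z` is `δ · b · Φ_A(z)` (unit boundary shear, LINEAR in `b`), hence cancels in
the type average; the remainder is the half-seam interaction `≲ (Σ_seam π₄)² ≈ δ^{1/2}`-controlled second-order
term plus the colour-blind core, whose four-arm amplitude vanishes by the measure-preserving involution
`flip ∘ coinflip ∘ rot_{π/2}(f)` (Hex duality), leaving `o(δ)` per bulk face; (iii) boundary layer: half-plane
three-arm pivotality `≈ δ²` per face near free/target arcs, wedge two-arm `≈ δ` on the `O(1)` faces at a marked
point — both `o(δ⁻¹)` in sum; (iv) uniformity over sparse backgrounds `p ≤ K δ`: approximate additivity of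
distant dislocations (`O(K)` cores per grid line; RSW and arm separation on the dislocated renewal lattice, whose
core-free simply connected regions develop isomorphically onto regions of `ℤ²`).  Tree inputs:
`Garban2011_fourArm_multiscale_holds` (`π₄(m,n) ≤ c (m/n)^{1+ε}`, bond-ℤ²), `annulusOpenCrossing_half_le_holds`,
BoxCrossingBounds/BoxCrossingJordan, QuadCrossingContinuity (kinked-domain step).  The sign structure is the
content: per dislocation the unsigned coupling cost is seam × four-arm `= δ^{1/4}` (reach `p ≪ δ^{3/2}` only). -/
theorem stub_signedDislocation : SignedDislocationBound := by
  sorry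

/-- **stub_russoWindow** (M, provable now). Margulis–Russo in the defect density: the crude crossing event of
the bounded window (`R.carrier` is bounded, `JordanDomain.isBounded`; the `2δ`-slack start/end sets are bounded)
is determined by finitely many bits — colours of the cells `v` in the window depend on `A`, `B` on a finite
range and on `D ∩ Rect(0, v) ⊆ [−C/δ, C/δ]²` —, so after Fubini over the other four factors `p ↦ P_p` is a
polynomial in `projIcc p` with `d/dp P_p = Σ_f I_f(p)` (general, non-monotone Russo: cylinder decomposition as
in `RussoPath.prodBernoulli_real_eq_sum_powerset`, pairing `S ↔ S ∪ {f}`); hence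
`|P_p − P_0| ≤ ∫_0^p Σ_f |I_f(q)| dq ≤ K δ · ε/δ = K ε` below the window (`projIcc` is the identity there once
`K δ ≤ 1`), which is `RegimeOne` after `ε ↦ ε/K`. -/
theorem stub_russoWindow : SignedDislocationBound → RegimeOne := by
  sorry

/-- **stub_largeScale** (hardest stub of the line; XL — the crux above the window, shared in content with the
companion line `symmetric-seed-second-order` (its `UniformCornerIrrelevance` in `ξ_t`-units implies this with
`K = K(ε)`) and with any fixed-`t` corner-irrelevance / transport mechanism).  Why it might hold: along `b = ½`
every `M(t,½)` is exactly self-dual and `D₄`-symmetric and the crossover at `ξ_t ≍ 1/t` is between two lattice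
realisations of one fixed point — no third scale (crux-item numerics: corner line at `t = 1, .4, .25` within
`1.5σ` of Cardy; exact TM Russo sums `S(t;n)` change sign at `t*(n) ≍ c/n` and stay flat below) —, so a bound
uniform in `ξ_t`-units is the natural output of any fixed-`t` mechanism, and `K` may be taken as large as
needed (constants may blow up polynomially in `ξ_t`).  Why it might fail: it contains corner irrelevance on
`p ∈ [Kδ, p_IK]`, conjunct-calibre (4-body plaquette field without FKG, Negative/CornerFaceNoMonotone), with the
CoveringLatticeShift `> 3/4` memory-rate residue for any single-bit Russo attack at fixed `t`; the hypothesis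
`CardyIKHyp` is available to it (anchor for a transport-plus-rigidity proof) and to nothing else in the line. -/
theorem stub_largeScale : LargeScaleIrrelevance := by
  sorry

/-- **stub_freezeToStandard** (M–L, provable path on tree inputs:
`Literature.Probability.Percolation.discreteCrossingProb_clusterPt_mem_Ioo_holds` and BoxCrossingJordan /
BoxCrossingBounds boundary RSW for bond-ℤ² in every conformal rectangle,
`JordanDomain.exists_forall_mem_meshDomain_and_reachable`, `mem_embDomainCrossing_iff`, isometry covariance of
`MarkedDomain.map` (`carrier_map`, `arc_map`), Mathlib's strong law for the i.i.d. geometric gaps; the live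
content of the route's support item `RenewalGridHarmless` stmt-4967, in law and with the `45°` rotation). -/
theorem stub_freezeToStandard : FreezeToStandard := by
  sorry

/-! ## Composition (kernel-checked, no sorry) -/

/-- The two windows OVERLAP at `p = K δ`: Regime I (every `K`) and large-scale irrelevance (some `K`) give
`|P_IK(R,δ) − P_0(R,δ)| ≤ ε` eventually, for every `ε > 0`. -/
theorem endgame (h1 : RegimeOne) (h3 : LargeScaleIrrelevance) (H : CardyIKHyp)
    (R : ConformalRectangle) (ε : ℝ) (hε : 0 < ε) :
    ∀ᶠ δ in 𝓝[>] (0 : ℝ), |gaugeCrossingProb pIK R δ - gaugeCrossingProb 0 R δ| ≤ ε := by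
  obtain ⟨K, hK, hlarge⟩ := h3 H R (ε / 2) (by positivity)
  have hsmall := h1 R (ε / 2) (by positivity) K hK
  have hpos : ∀ᶠ δ in 𝓝[>] (0 : ℝ), 0 < δ :=
    eventually_mem_nhdsWithin.mono fun δ hδ => Set.mem_Ioi.1 hδ
  filter_upwards [hlarge, hsmall, hpos] with δ hL hS hδ
  have hS' := hS (K * δ) (by positivity) le_rfl
  calc |gaugeCrossingProb pIK R δ - gaugeCrossingProb 0 R δ|
      ≤ |gaugeCrossingProb pIK R δ - gaugeCrossingProb (K * δ) R δ| +
          |gaugeCrossingProb (K * δ) R δ - gaugeCrossingProb 0 R δ| := abs_sub_le _ _ _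
    _ ≤ ε / 2 + ε / 2 := add_le_add hL hS'
    _ = ε := by ring

/-- Limits transfer along a vanishing difference: Cardy for `P_IK` in `R` plus the endgame gives Cardy for the
defect-free gauge `P_0` in `R`. -/
theorem hasCrossingLimit_zero (h1 : RegimeOne) (h3 : LargeScaleIrrelevance) (H : CardyIKHyp)
    (R : ConformalRectangle) : R.HasCrossingLimit (gaugeCrossingProb 0 R) cardyFunction := by
  intro φ x hφx
  have hIK : Tendsto (gaugeCrossingProb pIK R) (𝓝[>] 0) (𝓝 (cardyFunction (crossRatio x))) :=
    H R φ x hφx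
  have hdiff : Tendsto (fun δ => gaugeCrossingProb pIK R δ - gaugeCrossingProb 0 R δ)
      (𝓝[>] 0) (𝓝 0) := by
    rw [Metric.tendsto_nhds]
    intro ε hε
    filter_upwards [endgame h1 h3 H R (ε / 2) (by positivity)] with δ hδ
    rw [Real.dist_eq, sub_zero]
    linarith
  have h := hIK.sub hdiff
  simp only [sub_sub_cancel, sub_zero] at h
  exact h

/-- **The composition, closed form (no sorry):** the four statements imply the crux, stated with the crux
unfolded (`cornerLineDescent_iff`) so that only `CornerLineDescent_of` concludes the route decl by name. -/
theorem of_parts (h0 : SignedDislocationBound) (h2 : SignedDislocationBound → RegimeOne)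
    (h3 : LargeScaleIrrelevance) (h4 : FreezeToStandard) : CardyIKHyp → CrudeBondCardy :=
  fun H => h4 (hasCrossingLimit_zero (h2 h0) h3 H)

/-- **Skeleton theorem**: the crux BY NAME from the four registered stubs. -/
theorem CornerLineDescent_of : CardyIKTransport.CornerLineDescent :=
  cornerLineDescent_iff.mpr (of_parts stub_signedDislocation stub_russoWindow stub_largeScale stub_freezeToStandard)

end Summit.CriticalPhenomena.CardyFormulaZ2.Cruxes.CornerLineDescent.DislocationGasEndgame
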